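import Summits.CriticalPhenomena.SAWScalingLimit.Theorems.SAWLeftRightFKGFKGToTraversalBoundObstacleStraight
import Summits.CriticalPhenomena.SAWScalingLimit.Theorems.SAWLeftRightFKGFKGToTraversalBoundObstacleTurn
import Summits.CriticalPhenomena.SAWScalingLimit.Theorems.SAWLeftRightFKGFKGToTraversalBoundObstacleTriple
import Summits.CriticalPhenomena.SAWScalingLimit.Theorems.SAWLeftRightFKGFKGToTraversalBoundBlockMonotone
import HarnessLib

/-!
# Witness glue T5, part 2: block-monotone contact index along the tour, at the level of positions

Crux `SAWLeftRightFKG.FKGToTraversalBound` (stmt-CriticalPhenomena-1878), line `slit-necklace`, lead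
prover-line-stmt-CriticalPhenomena-1878-c5-0; witness glue unit T5 (block-monotone contact index on a far piece
along the outline arc), part 2 of 4.

Abstract obstacle setting (…ObstacleStraight/Turn/Triple.lean): `A ⊆ ℤ²` finite `4`-connected with at least two
sites, `e₀` a boundary edge of `A` whose wall-follower tour `btour A e₀` has period `N` without repeats, `r` a
lattice path of length `≥ 2` off `A` (the obstacle), an abscissa `Rbig` beyond `A ∪ r`, escapes `εu`, `εv` from
the endpoints of `r`, an `A`-edge `(a₀, c₀)` with an escape `εc` from `c₀`, and an escape from every outside
neighbour of `A` that is not an interior vertex of `r` — all escapes avoiding `A` and the interior of `r` and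
ending at abscissa `≥ Rbig`.

* `mono_posMonotone_left` (registered): if every contact of `A` with `r` is of LEFT type, there is a cut position
  `kcut` such that along positions `q < q' < N` of the tour not straddling the cut, the `r`-index of interior
  contacts is non-decreasing.  Proof: one tour step keeps the index (reflex corner), increases it
  (`obstacle_step_straight`) or satisfies the turn alternative (`obstacle_step_turn`); hence no bad triple
  (`obstacle_noBadTriple`); no `abab` pattern of two interior contact VALUES (`btour_abab` with two singletons);
  so `blockMonotone_of_noBadTriple_of_noAbab` applies to `good q := "the contact at q is an interior r-vertex"`,
  `idx q := its r-index`.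
* `mono_posMonotone_right`: the RIGHT-type case, non-increasing index — the left case for `r.reverse`.

All statements folklore; no literature fact; nothing restates the crux.
-/

noncomputable section

open Literature.Probability.LatticeModels

namespace Summit.CriticalPhenomena.SAWScalingLimit.Theorems.FKGToTraversalBound.SlitNecklace

/-! ### The step property of the contact index under the LEFT type -/

/-- **One tour step (LEFT type).**  If the contacts at positions `k` and `k + 1` of the tour are the interior
`r`-vertices `r_n`, `r_{n'}`, then `n ≤ n'`, or one of the two explicit wrap configurations of
`obstacle_step_turn` holds (the hypothesis shape of `obstacle_noBadTriple`).  By `bnext_cases`: a reflex corner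
keeps the contact, a straight step is `obstacle_step_straight`, a convex turn is `obstacle_step_turn`. [folklore] -/
theorem mono_step_left (A : Finset (Site 2)) (e₀ : Site 2 × ODir) {u v : Site 2} (r : (zdGraph 2).Walk u v)
    (Rbig : ℤ) (u₁ v₁ a₀ c₀ c₁ : Site 2) (εu : (zdGraph 2).Walk u u₁) (εv : (zdGraph 2).Walk v v₁)
    (εc : (zdGraph 2).Walk c₀ c₁) (he₀ : IsBEdge (↑A : Set (Site 2)) e₀) (hr : r.IsPath) (hL : 2 ≤ r.length)
    (hA2 : 2 ≤ A.card) (hA : ∀ x ∈ A, ∀ y ∈ A, ∃ w : (zdGraph 2).Walk x y, ∀ z ∈ w.support, z ∈ A)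
    (hrA : ∀ z ∈ r.support, z ∉ A)
    (hleft : ∀ (f : Site 2) (d : ODir) (m : ℕ), f ∈ A → 0 < m → m < r.length → r.getVert m = f + d.vec →
      (r.getVert (m + 1) = r.getVert m + d.ccw.vec ∨ r.getVert (m - 1) = r.getVert m - d.ccw.vec))
    (hR : ∀ z : Site 2, (z ∈ A ∨ z ∈ r.support) → z 0 + 2 ≤ Rbig) (hu₁ : Rbig ≤ u₁ 0) (hv₁ : Rbig ≤ v₁ 0)
    (hc₁ : Rbig ≤ c₁ 0) (hεu : ∀ z ∈ εu.support, z ∉ A ∧ ∀ n, 0 < n → n < r.length → z ≠ r.getVert n)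
    (hεv : ∀ z ∈ εv.support, z ∉ A ∧ ∀ n, 0 < n → n < r.length → z ≠ r.getVert n) (ha₀ : a₀ ∈ A)
    (hc₀ : c₀ ∉ A) (hac : (zdGraph 2).Adj a₀ c₀) (hc₀r : ∀ n, 0 < n → n < r.length → c₀ ≠ r.getVert n)
    (hεc : ∀ z ∈ εc.support, z ∉ A ∧ ∀ n, 0 < n → n < r.length → z ≠ r.getVert n) :
    ∀ (k n n' : ℕ), 0 < n → n < r.length → 0 < n' → n' < r.length →
      bcontact (btour (↑A : Set (Site 2)) e₀ k) = r.getVert n →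
      bcontact (btour (↑A : Set (Site 2)) e₀ (k + 1)) = r.getVert n' →
      (n ≤ n' ∨ (n + 1 = r.length ∧ n' + 2 ≤ n ∧ ∃ f ∈ A, ∃ d : ODir, r.getVert n = f + d.vec ∧
        r.getVert n' = f + d.ccw.vec ∧ r.getVert r.length = f + d.vec + d.ccw.vec ∧
        r.getVert (n' - 1) = r.getVert n' + d.ccw.vec) ∨ (n' = 1 ∧ 3 ≤ n ∧ ∃ f ∈ A, ∃ d : ODir,
        r.getVert n = f + d.vec ∧ r.getVert 1 = f + d.ccw.vec ∧ r.getVert 0 = f + d.vec + d.ccw.vec ∧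
        r.getVert (n + 1) = r.getVert n + d.vec)) := by
  intro k n n' hn0 hnL hn'0 hn'L hk hk'
  rcases hek : btour (↑A : Set (Site 2)) e₀ k with ⟨f, d⟩
  have he : IsBEdge (↑A : Set (Site 2)) (f, d) := hek ▸ btour_isBEdge _ he₀ k
  have hf : f ∈ A := Finset.mem_coe.1 he.1
  rw [hek] at hk
  rw [btour_succ, hek] at hk'
  have hk0 : r.getVert n = f + d.vec := hk.symm
  rcases bnext_cases (↑A : Set (Site 2)) f d with ⟨-, h1⟩ | ⟨ha, -, h2⟩ | ⟨-, -, h3⟩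
  · -- convex turn
    rw [h1] at hk'
    have hk1 : r.getVert n' = f + d.ccw.vec := hk'.symm
    rcases obstacle_step_turn A r Rbig u₁ v₁ a₀ c₀ c₁ εu εv εc f d n n' hr hL hA2 hA hrA hleft hR hu₁ hv₁ hc₁
        hεu hεv ha₀ hc₀ hac hc₀r hεc hf hn0 hnL hn'0 hn'L hk0 hk1 with h | ⟨h₁, h₂, h₃, h₄⟩ | ⟨h₁, h₂, h₃, h₄⟩
    · exact Or.inl h
    · exact Or.inr (Or.inl ⟨h₁, h₂, f, hf, d, hk0, hk1, h₃, h₄⟩)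
    · refine Or.inr (Or.inr ⟨h₁, h₂, f, hf, d, hk0, ?_, h₃, h₄⟩)
      rw [← h₁]; exact hk1
  · -- straight step
    rw [h2] at hk'
    have hk1 : r.getVert n' = f + d.ccw.vec + d.vec := hk'.symm
    exact Or.inl (obstacle_step_straight A r Rbig u₁ v₁ a₀ c₀ c₁ εu εv εc f d n n' hr hL hA hrA hleft hR hu₁
      hv₁ hc₁ hεu hεv ha₀ hc₀ hac hc₀r hεc hf hn0 hnL hn'0 hn'L hk0 (Finset.mem_coe.1 ha) hk1).le
  · -- reflex corner: same contact
    rw [h3] at hk'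
    have hk1 : r.getVert n' = f + d.vec := by
      rw [← hk']
      show f + d.vec + d.ccw.vec + d.cw.vec = f + d.vec
      rw [ODir.vec_cw, add_neg_cancel_right]
    have : n = n' := hr.getVert_injOn (by simp only [Set.mem_setOf_eq]; omega)
      (by simp only [Set.mem_setOf_eq]; omega) (hk0.trans hk1.symm)
    exact Or.inl this.le

/-! ### The registered part: LEFT type -/

/-- **Witness glue T5, part 2 (registered): block-monotone contact index at the level of positions, LEFT type.**
In the abstract obstacle setting (see the file header), if every contact of `A` with `r` is of LEFT type then
there is a cut `kcut` such that for positions `q < q' < N` not straddling the cut whose contacts are interior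
`r`-vertices `r_n`, `r_{n'}`, one has `n ≤ n'`.  (`mono_step_left` ⇒ `obstacle_noBadTriple`; `btour_abab` with two
singleton contact values ⇒ no `abab`; `blockMonotone_of_noBadTriple_of_noAbab`.) [folklore] -/
theorem mono_posMonotone_left : ∀ (A : Finset (Site 2)) (e₀ : Site 2 × ODir) (N : ℕ) {u v : Site 2} (r : (zdGraph 2).Walk u v) (Rbig : ℤ) (u₁ v₁ a₀ c₀ c₁ : Site 2) (εu : (zdGraph 2).Walk u u₁) (εv : (zdGraph 2).Walk v v₁) (εc : (zdGraph 2).Walk c₀ c₁), IsBEdge (↑A : Set (Site 2)) e₀ → 0 < N → btour (↑A : Set (Site 2)) e₀ N = e₀ → (∀ j j', j < N → j' < N → btour (↑A : Set (Site 2)) e₀ j = btour (↑A : Set (Site 2)) e₀ j' → j = j') → r.IsPath → 2 ≤ r.length → 2 ≤ A.card → (∀ x ∈ A, ∀ y ∈ A, ∃ w : (zdGraph 2).Walk x y, ∀ z ∈ w.support, z ∈ A) → (∀ z ∈ r.support, z ∉ A) → (∀ (f : Site 2) (d : ODir) (m : ℕ), f ∈ A → 0 < m → m < r.length → r.getVert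 m = f + d.vec → (r.getVert (m + 1) = r.getVert m + d.ccw.vec ∨ r.getVert (m - 1) = r.getVert m - d.ccw.vec)) → (∀ z : Site 2, (z ∈ A ∨ z ∈ r.support) → z 0 + 2 ≤ Rbig) → Rbig ≤ u₁ 0 → Rbig ≤ v₁ 0 → Rbig ≤ c₁ 0 → (∀ z ∈ εu.support, z ∉ A ∧ ∀ n, 0 < n → n < r.length → z ≠ r.getVert n) → (∀ z ∈ εv.support, z ∉ A ∧ ∀ n, 0 < n → n < r.length → z ≠ r.getVert n) → a₀ ∈ A → c₀ ∉ A → (zdGraph 2).Adj a₀ c₀ → (∀ n, 0 < n → n < r.length → c₀ ≠ r.getVert n) → (∀ z ∈ εc.support, z ∉ A ∧ ∀ n, 0 < n → n < r.length → z ≠ r.getVert n) → (∀ c : Site 2, c ∉ A → (∀ n, 0 < n → n < r.length → c ≠ r.getVert n) → (∃ a ∈ A, (zdGraph 2).Adj a c) → ∃ (c' : Site 2) (ε : (zdGraph 2).Walk c c'), Rbig ≤ c' 0 ∧ ∀ z ∈ ε.support, z ∉ A ∧ ∀ n, 0 < n → n < r.length → z ≠ r.getVert n) → ∃ kcut : ℕ,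 ∀ (q q' n n' : ℕ), q < q' → q' < N → (q' < kcut ∨ kcut ≤ q) → 0 < n → n < r.length → 0 < n' → n' < r.length → bcontact (btour (↑A : Set (Site 2)) e₀ q) = r.getVert n → bcontact (btour (↑A : Set (Site 2)) e₀ q') = r.getVert n' → n ≤ n' := by
  intro A e₀ N u v r Rbig u₁ v₁ a₀ c₀ c₁ εu εv εc he₀ hNpos hN hinj hr hL hA2 hA hrA hleft hR hu₁ hv₁ hc₁ hεu hεv
    ha₀ hc₀ hac hc₀r hεc hesc
  classical
  -- `good` positions (the contact is an interior `r`-vertex) and their index, as functions of the tour edge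
  let goodE : Site 2 × ODir → Prop := fun e => ∃ n, 0 < n ∧ n < r.length ∧ bcontact e = r.getVert n
  let idxE : Site 2 × ODir → ℕ := fun e => if h : goodE e then Nat.find h else 0
  have hspec : ∀ e, goodE e → 0 < idxE e ∧ idxE e < r.length ∧ bcontact e = r.getVert (idxE e) := by
    intro e he
    have : idxE e = Nat.find he := dif_pos he
    rw [this]
    exact Nat.find_spec he
  have hidx : ∀ e n, 0 < n → n < r.length → bcontact e = r.getVert n → idxE e = n := by
    intro e n hn0 hnL he
    obtain ⟨h0, hL', hc⟩ := hspec e ⟨n, hn0, hnL, he⟩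
    exact hr.getVert_injOn (by simp only [Set.mem_setOf_eq]; omega) (by simp only [Set.mem_setOf_eq]; omega)
      (hc.symm.trans he)
  let good : ℕ → Prop := fun q => goodE (btour (↑A : Set (Site 2)) e₀ q)
  let idx : ℕ → ℕ := fun q => idxE (btour (↑A : Set (Site 2)) e₀ q)
  have hgoodN : ∀ q, good (q + N) ↔ good q := fun q => by
    simp only [good, btour_add_of_eq _ hN]
  have hidxN : ∀ q, idx (q + N) = idx q := fun q => by
    simp only [idx, btour_add_of_eq _ hN]
  have hgs : ∀ q, good q → 0 < idx q ∧ idx q < r.length ∧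
      bcontact (btour (↑A : Set (Site 2)) e₀ q) = r.getVert (idx q) := fun q hq => hspec _ hq
  -- the step property and no bad triple
  have hstep := mono_step_left A e₀ r Rbig u₁ v₁ a₀ c₀ c₁ εu εv εc he₀ hr hL hA2 hA hrA hleft hR hu₁ hv₁ hc₁ hεu
    hεv ha₀ hc₀ hac hc₀r hεc
  have htri : ∀ x y z, x < y → y < z → z < x + N → good x → good y → good z →
      ¬ (idx x < idx z ∧ (idx y < idx x ∨ idx z < idx y)) := by
    intro x y z hxy hyz hzx gx gy gz h
    obtain ⟨hx0, hxL, hx⟩ := hgs x gx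
    obtain ⟨hy0, hyL, hy⟩ := hgs y gy
    obtain ⟨hz0, hzL, hz⟩ := hgs z gz
    exact obstacle_noBadTriple A e₀ N r Rbig u₁ v₁ εu εv x y z (idx x) (idx y) (idx z) he₀ hNpos hN hinj hr hL hA
      hrA hR hu₁ hv₁ hεu hεv hesc hstep hxy hyz hzx hx0 hxL hy0 hyL hz0 hzL hx hy hz h.1 h.2
  -- no `abab` of two interior contact values
  have habab : ¬ ∃ p₁ p₂ p₃ p₄, p₁ < p₂ ∧ p₂ < p₃ ∧ p₃ < p₄ ∧ p₄ < N ∧ good p₁ ∧ good p₂ ∧ good p₃ ∧ good p₄ ∧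
      idx p₁ = idx p₃ ∧ idx p₂ = idx p₄ ∧ idx p₁ ≠ idx p₂ := by
    rintro ⟨p₁, p₂, p₃, p₄, h12, h23, h34, h4N, g1, g2, g3, g4, e13, e24, ne12⟩
    obtain ⟨_, h1L, h1⟩ := hgs p₁ g1
    obtain ⟨_, h2L, h2⟩ := hgs p₂ g2
    obtain ⟨-, -, h3⟩ := hgs p₃ g3
    obtain ⟨-, -, h4⟩ := hgs p₄ g4
    have hrAi : ∀ i, r.getVert i ∉ (↑A : Set (Site 2)) := fun i h =>
      hrA _ (r.getVert_mem_support i) (Finset.mem_coe.1 h)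
    have hne : r.getVert (idx p₁) ≠ r.getVert (idx p₂) := fun h =>
      ne12 (hr.getVert_injOn (by simp only [Set.mem_setOf_eq]; omega) (by simp only [Set.mem_setOf_eq]; omega) h)
    have hsing : ∀ w : Site 2, ∀ x ∈ ({w} : Set (Site 2)), ∀ x' ∈ ({w} : Set (Site 2)),
        ∃ p : (zdGraph 2).Walk x x', ∀ z ∈ p.support, z ∈ ({w} : Set (Site 2)) := by
      intro w x hx x' hx'
      rw [Set.mem_singleton_iff] at hx hx'
      subst hx hx'
      exact ⟨SimpleGraph.Walk.nil, fun z hz => by simpa using hz⟩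
    refine btour_abab A {r.getVert (idx p₁)} {r.getVert (idx p₂)} e₀ p₁ p₂ p₃ p₄ N he₀ hA
      (fun x hx => by rw [Set.mem_singleton_iff] at hx; exact hx ▸ hrAi _)
      (fun y hy => by rw [Set.mem_singleton_iff] at hy; exact hy ▸ hrAi _)
      (Set.disjoint_singleton.2 hne) (hsing _) (hsing _) h12 h23 h34 (by omega) hN hinj ?_ ?_ ?_ ?_
    · exact Set.mem_singleton_iff.2 h1
    · exact Set.mem_singleton_iff.2 h2
    · rw [Set.mem_singleton_iff, h3, e13]
    · rw [Set.mem_singleton_iff, h4, e24]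
  -- block monotonicity
  obtain ⟨kcut, hk⟩ := blockMonotone_of_noBadTriple_of_noAbab N good idx htri hgoodN hidxN habab
  refine ⟨kcut, fun q q' n n' hqq' hq'N hcut hn0 hnL hn'0 hn'L hq hq' => ?_⟩
  have h := hk q q' hqq' hq'N ⟨n, hn0, hnL, hq⟩ ⟨n', hn'0, hn'L, hq'⟩ hcut
  have e1 : idx q = n := hidx _ n hn0 hnL hq
  have e2 : idx q' = n' := hidx _ n' hn'0 hn'L hq'
  rw [e1, e2] at h
  exact h

/-! ### The RIGHT type, by reversing the obstacle path -/

/-- Interior vertices of `r.reverse` are the interior vertices of `r`. [folklore] -/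
theorem mono_interior_reverse_iff {u v : Site 2} (r : (zdGraph 2).Walk u v) (z : Site 2) :
    (∀ n, 0 < n → n < r.reverse.length → z ≠ r.reverse.getVert n) ↔
      (∀ n, 0 < n → n < r.length → z ≠ r.getVert n) := by
  rw [SimpleGraph.Walk.length_reverse]
  constructor
  · intro h n hn0 hnL
    have := h (r.length - n) (by omega) (by omega)
    rwa [SimpleGraph.Walk.getVert_reverse, Nat.sub_sub_self hnL.le] at this
  · intro h n hn0 hnL
    rw [SimpleGraph.Walk.getVert_reverse]
    exact h _ (by omega) (by omega)

/-- **Block-monotone contact index at the level of positions, RIGHT type.**  Same setting as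
`mono_posMonotone_left` with every contact of RIGHT type; then the `r`-index of interior contacts is
non-INCREASING along positions not straddling a cut (the left case for `r.reverse`, whose contacts are of left type
with index `|r| - n`). [folklore] -/
theorem mono_posMonotone_right : ∀ (A : Finset (Site 2)) (e₀ : Site 2 × ODir) (N : ℕ) {u v : Site 2} (r : (zdGraph 2).Walk u v) (Rbig : ℤ) (u₁ v₁ a₀ c₀ c₁ : Site 2) (εu : (zdGraph 2).Walk u u₁) (εv : (zdGraph 2).Walk v v₁) (εc : (zdGraph 2).Walk c₀ c₁), IsBEdge (↑A : Set (Site 2)) e₀ → 0 < N → btour (↑A : Set (Site 2)) e₀ N = e₀ → (∀ j j', j < N → j' < N → btour (↑A : Set (Site 2)) e₀ j = btour (↑A : Set (Site 2)) e₀ j' → j = j') → r.IsPath → 2 ≤ r.length → 2 ≤ A.card → (∀ x ∈ A, ∀ y ∈ A, ∃ w : (zdGraph 2).Walk x y, ∀ z ∈ w.support, z ∈ A) → (∀ z ∈ r.support, z ∉ A) → (∀ (f : Site 2) (d : ODir) (m : ℕ), f ∈ A → 0 < m → m < r.length → r.getVert m = f + d.vec → (r.getVert (m + 1) = r.getVert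 m - d.ccw.vec ∨ r.getVert (m - 1) = r.getVert m + d.ccw.vec)) → (∀ z : Site 2, (z ∈ A ∨ z ∈ r.support) → z 0 + 2 ≤ Rbig) → Rbig ≤ u₁ 0 → Rbig ≤ v₁ 0 → Rbig ≤ c₁ 0 → (∀ z ∈ εu.support, z ∉ A ∧ ∀ n, 0 < n → n < r.length → z ≠ r.getVert n) → (∀ z ∈ εv.support, z ∉ A ∧ ∀ n, 0 < n → n < r.length → z ≠ r.getVert n) → a₀ ∈ A → c₀ ∉ A → (zdGraph 2).Adj a₀ c₀ → (∀ n, 0 < n → n < r.length → c₀ ≠ r.getVert n) → (∀ z ∈ εc.support, z ∉ A ∧ ∀ n, 0 < n → n < r.length → z ≠ r.getVert n) → (∀ c : Site 2, c ∉ A → (∀ n, 0 < n → n < r.length → c ≠ r.getVert n) → (∃ a ∈ A, (zdGraph 2).Adj a c) → ∃ (c' : Site 2) (ε : (zdGraph 2).Walk c c'), Rbig ≤ c' 0 ∧ ∀ z ∈ ε.support, z ∉ A ∧ ∀ n, 0 < n → n < r.length → z ≠ r.getVert n) → ∃ kcut : ℕ, ∀ (q q' n n' : ℕ), q < q' → q'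 < N → (q' < kcut ∨ kcut ≤ q) → 0 < n → n < r.length → 0 < n' → n' < r.length → bcontact (btour (↑A : Set (Site 2)) e₀ q) = r.getVert n → bcontact (btour (↑A : Set (Site 2)) e₀ q') = r.getVert n' → n' ≤ n := by
  intro A e₀ N u v r Rbig u₁ v₁ a₀ c₀ c₁ εu εv εc he₀ hNpos hN hinj hr hL hA2 hA hrA hright hR hu₁ hv₁ hc₁ hεu hεv
    ha₀ hc₀ hac hc₀r hεc hesc
  have hLrev : r.reverse.length = r.length := SimpleGraph.Walk.length_reverse _
  have hgv : ∀ i, r.reverse.getVert i = r.getVert (r.length - i) := SimpleGraph.Walk.getVert_reverse r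
  have hsupp : ∀ z ∈ r.reverse.support, z ∉ A := fun z hz => by
    rw [SimpleGraph.Walk.support_reverse, List.mem_reverse] at hz
    exact hrA z hz
  have hR' : ∀ z : Site 2, (z ∈ A ∨ z ∈ r.reverse.support) → z 0 + 2 ≤ Rbig := fun z hz => by
    rw [SimpleGraph.Walk.support_reverse, List.mem_reverse] at hz
    exact hR z hz
  have hesc_tr : ∀ {a b : Site 2} (ε : (zdGraph 2).Walk a b),
      (∀ z ∈ ε.support, z ∉ A ∧ ∀ n, 0 < n → n < r.length → z ≠ r.getVert n) →
      ∀ z ∈ ε.support, z ∉ A ∧ ∀ n, 0 < n → n < r.reverse.length → z ≠ r.reverse.getVert n :=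
    fun ε h z hz => ⟨(h z hz).1, (mono_interior_reverse_iff r z).2 (h z hz).2⟩
  -- the contacts of `r.reverse` are of left type
  have hleft : ∀ (f : Site 2) (d : ODir) (m : ℕ), f ∈ A → 0 < m → m < r.reverse.length →
      r.reverse.getVert m = f + d.vec → (r.reverse.getVert (m + 1) = r.reverse.getVert m + d.ccw.vec ∨
        r.reverse.getVert (m - 1) = r.reverse.getVert m - d.ccw.vec) := by
    intro f d m hf hm0 hmL hm
    rw [hLrev] at hmL
    rw [hgv] at hm
    rw [hgv, hgv, hgv]
    rcases hright f d (r.length - m) hf (by omega) (by omega) hm with h | h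
    · right
      rw [show r.length - (m - 1) = r.length - m + 1 by omega, h, sub_eq_add_neg]
    · left
      rw [show r.length - (m + 1) = r.length - m - 1 by omega, h]
  obtain ⟨kcut, hk⟩ := mono_posMonotone_left A e₀ N r.reverse Rbig v₁ u₁ a₀ c₀ c₁ εv εu εc he₀ hNpos hN hinj
    hr.reverse (by rw [hLrev]; exact hL) hA2 hA hsupp hleft hR' hv₁ hu₁ hc₁ (hesc_tr εv hεv) (hesc_tr εu hεu) ha₀
    hc₀ hac ((mono_interior_reverse_iff r c₀).2 hc₀r) (hesc_tr εc hεc) (fun c hcA hcr hadj => by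
      obtain ⟨c', ε, hc', hε⟩ := hesc c hcA ((mono_interior_reverse_iff r c).1 hcr) hadj
      exact ⟨c', ε, hc', hesc_tr ε hε⟩)
  refine ⟨kcut, fun q q' n n' hqq' hq'N hcut hn0 hnL hn'0 hn'L hq hq' => ?_⟩
  have h := hk q q' (r.length - n) (r.length - n') hqq' hq'N hcut (by omega) (by rw [hLrev]; omega) (by omega)
    (by rw [hLrev]; omega) (by rw [hgv, Nat.sub_sub_self hnL.le]; exact hq)
    (by rw [hgv, Nat.sub_sub_self hn'L.le]; exact hq')
  omega

end Summit.CriticalPhenomena.SAWScalingLimit.Theorems.FKGToTraversalBound.SlitNecklace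

end
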